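import Literature.MathematicalPhysics.QuantumLattice.InfVolFermionStateProduct
import HarnessLib

/-!
# Product states over boxes with disjoint images: density matrix, product formula, and MARGINALS
# (the marginal of a fermionic product state on a window is the product of the part marginals)

Topic `Literature/MathematicalPhysics/QuantumLattice` (namespace = path; family `hubbard`, model-free). Written for
the `T > 0` certificate family of the Hubbard material-oracle programme (sr-mbsolver/hubbard-thermal, technique (ii),
certificate **C3** = seam-dressed cluster product trial states in the Gibbs variational principle): the trial state
on a torus tiled by boxes is `W · Π_k Γ_{φ_k}(σ_k) · Wᴴ`, and the energy of a local term dressed by the gates meeting it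
is a trace over a small WINDOW against the marginal of `Π_k Γ_{φ_k}(σ_k)` there. This file is the finite-dimensional
bookkeeping of such product states, in the encoding of `InfVolFermionStateProduct.lean` (Araki–Moriya's device: even
density matrices of disjoint regions commute, their product is positive, and the tracial state `τ` has the product
property) but for an arbitrary finite family of BOXES `φ_k : Λ₀ k ↪ Λ` (box shapes may depend on `k`) with pairwise
disjoint images in an arbitrary finite ordered site set `Λ` — no lattice, no tiling of `ℤ^d`.

* §1 `boxProd φ hφ a ha S = Π_{k ∈ S} Γ_{φ_k}(a_k)` (`Finset.noncommProd`; the factors are `Θ`-even, hence commute):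
  even, localised, positive semidefinite for positive semidefinite factors, `τ(Π_k Γ_k a_k) = Π_k τ(a_k)`
  (`normTrace_boxProd`), and `tr = 1` for density matrices on boxes TILING `Λ` (`trace_boxProd_univ_eq_one`).
* §2 **the product formula** `normTrace_boxProd_mul_prod`: against an ordered product of box observables of DISTINCT
  boxes, `τ(Π_{k∈S} Γ_k a_k · Π_i Γ_{k_i} b_i) = Π_i τ(a_{k_i} b_i) · Π_{k ∈ S, k ∉ {k_i}} τ(a_k)`
  [cite: ArakiMoriya2003, §11.1 Theorem 11.2 eq. (11.4)].
* §3 **marginals** (`fermionPartialTrace_boxProd`): for a window `ι : Ω ↪ Λ` partitioned into PARTS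
  `lam k : P k ↪ Ω` lying in the boxes (`φ_k ∘ κ_k = ι ∘ lam_k` with `κ k : P k ↪ Λ₀ k`), the marginal of the product
  state of even box density matrices is the product of the embedded part marginals:
  `tr_ι (Π_k Γ_{φ_k} σ_k) = Π_k Γ_{lam_k} (tr_{κ_k} σ_k)` — boxes not meeting the window contribute `𝟙`
  [cite: ArakiMoriya2003, §4.1 Def. 4.5, §11.1 Theorem 11.2]. Proof: both sides pair identically with every
  class-sorted word of `𝔄_Ω` (`wordOp_eq_sign_smul_prod_filter`, the product formula on `Ω` and on `Λ`, and the
  defining duality of `fermionPartialTrace`), and words are total.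

Everything is PROVED; the one definition (`boxProd`) is a `noncommProd` with its commutation witness; no named fact.

## Tree / Mathlib search

REUSED: `normTrace`, `normTrace_mul_of_mem_carSubalgebra`, `normTrace_fermionEmbed`, `wordOp_eq_sign_smul_prod_filter`
(`InfVolFermionStateProduct`); `fermionEmbed_mem_carSubalgebra/EvenSubalgebra`, `fermionEmbed_letterOp`
(`FermionEmbedLocality`); `commute_of_mem_carEvenSubalgebra`, `mem_span_wordOp_of_mem_carSubalgebra`
(`FermionTraceFactorization`); `JordanWigner.mem_carEvenSubalgebra_univ_of_parityAut_eq`; `fermionPartialTrace`,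
`trace_mul_fermionPartialTrace`, `eq_fermionPartialTrace_of_forall_trace_mul`, `parityAut_fermionPartialTrace_of_even`
(`FermionPartialTrace`); `posSemidef_fermionEmbed`; `Literature.LinearAlgebra.Matrix.posSemidef_mul_of_posSemidef_of_commute`.
The same-shape, `ℤ^d`-tiling special case is `InfVolFermionStateProduct.normTrace_tileFactorProd_mul_prod`; the
same-shape leg family is `LayeredSystemPartitionFunction.normTrace_noncommProd_fermionEmbed` (neither has marginals).

## References

* H. Araki, H. Moriya, Rev. Math. Phys. 15 (2003) 93, §4.1 (Def. 4.5: restriction of a state; eq. (4.16): product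
  property of `τ`), §11.1 Theorem 11.2 (product states of even states). [cite: ArakiMoriya2003, §11.1 Theorem 11.2]
* O. Bratteli, D. W. Robinson, *Operator Algebras and Quantum Statistical Mechanics 2* (1997), §5.2.2.
  [cite: BratteliRobinsonII1997, §5.2.2]
-/

noncomputable section

namespace Literature.MathematicalPhysics.QuantumLattice

open Matrix Finset HubbardWave0
open scoped ComplexOrder BigOperators

/-! ### §1. The box product `Π_k Γ_{φ_k}(a_k)` -/

section BoxProd

variable {Λ : Type*} [LinearOrder Λ] [Fintype Λ] {K : Type*}
  {Λ₀ : K → Type*} [∀ k, LinearOrder (Λ₀ k)] [∀ k, Fintype (Λ₀ k)]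
  (φ : ∀ k, Λ₀ k ↪ Λ)

/-- **The orbitals of box `k`** (over the image sites of `φ k`). [cite: ArakiMoriya2003, §4.1 Def. 4.1 (2)] -/
abbrev boxOrbs (k : K) : Finset (Orb Λ) := orbs ((Finset.univ : Finset (Λ₀ k)).map (φ k))

variable {φ}
  (hφ : ∀ k j, k ≠ j → Disjoint ((Finset.univ : Finset (Λ₀ k)).map (φ k)) ((Finset.univ : Finset (Λ₀ j)).map (φ j)))
include hφ

/-- An even operator on one box commutes with every operator on another box (graded locality).
[cite: BratteliRobinsonII1997, §5.2.2] -/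
theorem commute_fermionEmbed_box_of_parityAut_eq {k j : K} (hkj : k ≠ j)
    {a : Matrix (Finset (Orb (Λ₀ k))) (Finset (Orb (Λ₀ k))) ℂ} (ha : parityAut a = a)
    (b : Matrix (Finset (Orb (Λ₀ j))) (Finset (Orb (Λ₀ j))) ℂ) :
    Commute (fermionEmbed (φ k) a) (fermionEmbed (φ j) b) :=
  commute_of_mem_carEvenSubalgebra
    (fermionEmbed_mem_carEvenSubalgebra _ (JordanWigner.mem_carEvenSubalgebra_univ_of_parityAut_eq ha))
    (fermionEmbed_mem_carSubalgebra _ _) (disjoint_orbs (hφ k j hkj))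

/-- The pairwise-commutation witness for `Finset.noncommProd` of box-embedded even operators.
[cite: BratteliRobinsonII1997, §5.2.2] -/
theorem pairwise_commute_fermionEmbed_box {a : ∀ k, Matrix (Finset (Orb (Λ₀ k))) (Finset (Orb (Λ₀ k))) ℂ}
    (ha : ∀ k, parityAut (a k) = a k) (S : Finset K) :
    (S : Set K).Pairwise fun k j => Commute (fermionEmbed (φ k) (a k)) (fermionEmbed (φ j) (a j)) :=
  fun k _ j _ hkj => commute_fermionEmbed_box_of_parityAut_eq hφ hkj (ha k) (a j)

/-- **The box product** `Π_{k ∈ S} Γ_{φ_k}(a_k)` of `Θ`-even box operators (well defined: the factors commute).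
For even box DENSITY MATRICES this is Araki–Moriya's product state of the boxes in `S` (times the tracial state
elsewhere). [cite: ArakiMoriya2003, §11.1 Theorem 11.2 eq. (11.5)] -/
def boxProd (a : ∀ k, Matrix (Finset (Orb (Λ₀ k))) (Finset (Orb (Λ₀ k))) ℂ) (ha : ∀ k, parityAut (a k) = a k)
    (S : Finset K) : Matrix (Finset (Orb Λ)) (Finset (Orb Λ)) ℂ :=
  S.noncommProd (fun k => fermionEmbed (φ k) (a k)) (pairwise_commute_fermionEmbed_box hφ ha S)

variable {a : ∀ k, Matrix (Finset (Orb (Λ₀ k))) (Finset (Orb (Λ₀ k))) ℂ} (ha : ∀ k, parityAut (a k) = a k)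

/-- The empty box product is `𝟙`. [cite: ArakiMoriya2003, §11.1] -/
theorem boxProd_empty : boxProd hφ a ha ∅ = 1 :=
  Finset.noncommProd_empty _ _

omit [Fintype Λ] [∀ k, LinearOrder (Λ₀ k)] in
/-- The orbitals of a box outside `S` are disjoint from those of the boxes in `S`. [folklore] -/
private theorem disjoint_boxOrbs_biUnion {S : Finset K} {k : K} (hk : k ∉ S) :
    Disjoint (boxOrbs φ k) (S.biUnion (boxOrbs φ)) :=
  (Finset.disjoint_biUnion_right _ _ _).2 fun j hj => disjoint_orbs (hφ k j fun h => hk (h ▸ hj))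

/-- The box product over `S` is an even element localised on the orbitals of the boxes in `S`.
[cite: ArakiMoriya2003, §11.1 Theorem 11.2] -/
theorem boxProd_mem_carEvenSubalgebra (S : Finset K) :
    boxProd hφ a ha S ∈ carEvenSubalgebra (S.biUnion (boxOrbs φ)) := by
  refine Finset.noncommProd_induction S _ _ (· ∈ carEvenSubalgebra (S.biUnion (boxOrbs φ)))
    (fun x y hx hy => Subalgebra.mul_mem _ hx hy) (Subalgebra.one_mem _) fun k hk => ?_
  exact carEvenSubalgebra_mono (Finset.subset_biUnion_of_mem _ hk)
    (fermionEmbed_mem_carEvenSubalgebra _ (JordanWigner.mem_carEvenSubalgebra_univ_of_parityAut_eq (ha k)))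

/-- … in particular localised on those orbitals. [cite: ArakiMoriya2003, §11.1 Theorem 11.2] -/
theorem boxProd_mem_carSubalgebra (S : Finset K) : boxProd hφ a ha S ∈ carSubalgebra (S.biUnion (boxOrbs φ)) :=
  carEvenSubalgebra_le_carSubalgebra _ (boxProd_mem_carEvenSubalgebra hφ ha S)

variable [DecidableEq K]

/-- Splitting off one factor: `Π_S = Γ_k a_k · Π_{S ∖ k}` for `k ∈ S`. [cite: ArakiMoriya2003, §11.1 Theorem 11.2] -/
theorem boxProd_eq_mul_erase {S : Finset K} {k : K} (hk : k ∈ S) :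
    boxProd hφ a ha S = fermionEmbed (φ k) (a k) * boxProd hφ a ha (S.erase k) :=
  (Finset.mul_noncommProd_erase S hk (fun k => fermionEmbed (φ k) (a k))
    (pairwise_commute_fermionEmbed_box hφ ha S) (pairwise_commute_fermionEmbed_box hφ ha (S.erase k))).symm

/-- Inserting a new box: `Π_{insert k S} = Γ_k a_k · Π_S` for `k ∉ S`. [cite: ArakiMoriya2003, §11.1 Theorem 11.2] -/
theorem boxProd_insert {S : Finset K} {k : K} (hk : k ∉ S) :
    boxProd hφ a ha (insert k S) = fermionEmbed (φ k) (a k) * boxProd hφ a ha S := by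
  rw [boxProd_eq_mul_erase hφ ha (Finset.mem_insert_self k S), Finset.erase_insert hk]

/-- The box product is `Θ`-even. [cite: ArakiMoriya2003, §11.1 Lemma 11.1] -/
theorem parityAut_boxProd (S : Finset K) : parityAut (boxProd hφ a ha S) = boxProd hφ a ha S := by
  induction S using Finset.induction_on with
  | empty => rw [boxProd_empty, map_one]
  | insert k S hk ih => rw [boxProd_insert hφ ha hk, map_mul, ← fermionEmbed_parityAut, ha, ih]

/-- **The box product of positive semidefinite even operators is positive semidefinite** (a product of
commuting positive semidefinite matrices).
[cite: ArakiMoriya2003, §11.1 Theorem 11.2 ("a product of mutually commuting non-negative hermitian operators")] -/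
theorem posSemidef_boxProd (hpsd : ∀ k, (a k).PosSemidef) (S : Finset K) : (boxProd hφ a ha S).PosSemidef := by
  induction S using Finset.induction_on with
  | empty => rw [boxProd_empty]; exact Matrix.PosSemidef.one
  | insert k S hk ih =>
    rw [boxProd_insert hφ ha hk]
    refine Literature.LinearAlgebra.Matrix.posSemidef_mul_of_posSemidef_of_commute
      (posSemidef_fermionEmbed _ (hpsd k)) ih ?_
    exact Finset.noncommProd_commute _ _ _ _ fun j hj =>
      commute_fermionEmbed_box_of_parityAut_eq hφ (ne_of_mem_of_not_mem hj hk).symm (ha k) (a j)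

/-- **The tracial state factorises over the boxes**: `τ(Π_{k∈S} Γ_k a_k) = Π_{k∈S} τ(a_k)`.
[cite: ArakiMoriya2003, §4.1 eq. (4.16)] -/
theorem normTrace_boxProd (S : Finset K) : normTrace (boxProd hφ a ha S) = ∏ k ∈ S, normTrace (a k) := by
  induction S using Finset.induction_on with
  | empty => rw [boxProd_empty, normTrace_one, Finset.prod_empty]
  | insert k S hk ih =>
    rw [boxProd_insert hφ ha hk, Finset.prod_insert hk,
      normTrace_mul_of_mem_carSubalgebra (fermionEmbed_mem_carSubalgebra _ _) (boxProd_mem_carSubalgebra hφ ha S)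
        (disjoint_boxOrbs_biUnion hφ hk),
      normTrace_fermionEmbed, ih]

omit hφ in
/-- Orbital count: `|Orb X| = 2 |X|` (two spins per site). [folklore] -/
private theorem card_orb_eq_two_mul (X : Type*) [LinearOrder X] [Fintype X] : Fintype.card (Orb X) = 2 * Fintype.card X := by
  rw [Fintype.card_congr (show Orb X ≃ X × Fin 2 from (toLex : X × Fin 2 ≃ Orb X).symm), Fintype.card_prod,
    Fintype.card_fin, mul_comm]

/-- **`tr Π_k Γ_k σ_k = 1` for density matrices on boxes TILING `Λ`** (`Σ_k |Λ₀ k| = |Λ|`, `tr σ_k = 1`).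
[cite: ArakiMoriya2003, §11.1 Theorem 11.2 ("This also shows `φ(𝟙) = 1`")] -/
theorem trace_boxProd_univ_eq_one [Fintype K] (htr : ∀ k, (a k).trace = 1)
    (hcard : ∑ k, Fintype.card (Λ₀ k) = Fintype.card Λ) : (boxProd hφ a ha Finset.univ).trace = 1 := by
  have h := normTrace_boxProd hφ ha (Finset.univ : Finset K)
  simp only [normTrace_apply, htr, one_div] at h
  rw [Finset.prod_inv_distrib, Finset.prod_pow_eq_pow_sum, div_eq_iff (pow_ne_zero _ two_ne_zero)] at h
  rw [h, card_orb_eq_two_mul]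
  simp_rw [card_orb_eq_two_mul]
  rw [← Finset.mul_sum, hcard, inv_mul_cancel₀ (pow_ne_zero _ two_ne_zero)]

/-! ### §2. The product formula -/

omit [DecidableEq K] hφ in
/-- A list product of box-embedded observables of boxes in `S` is localised on the orbitals of `S`.
[cite: ArakiMoriya2003, §11.1] -/
theorem prod_map_fermionEmbed_box_mem_carSubalgebra {S : Finset K}
    (L : List (Σ k : K, Matrix (Finset (Orb (Λ₀ k))) (Finset (Orb (Λ₀ k))) ℂ)) (hLS : ∀ p ∈ L, p.1 ∈ S) :
    (L.map fun p => fermionEmbed (φ p.1) p.2).prod ∈ carSubalgebra (S.biUnion (boxOrbs φ)) := by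
  induction L with
  | nil => rw [List.map_nil, List.prod_nil]; exact Subalgebra.one_mem _
  | cons p L ih =>
    rw [List.map_cons, List.prod_cons]
    exact Subalgebra.mul_mem _
      (carSubalgebra_mono (Finset.subset_biUnion_of_mem _ (hLS p List.mem_cons_self)) (fermionEmbed_mem_carSubalgebra _ _))
      (ih fun q hq => hLS q (List.mem_cons_of_mem _ hq))

/-- **THE PRODUCT FORMULA** (Araki–Moriya Thm. 11.2 (11.4)) for boxes of arbitrary shapes: against an ordered
product of observables of DISTINCT boxes `k_1, …, k_r ∈ S` the box product of even operators gives
`τ(Π_{k∈S} Γ_k a_k · Π_i Γ_{k_i} b_i) = Π_i τ(a_{k_i} b_i) · Π_{k ∈ S ∖ {k_i}} τ(a_k)`.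
[cite: ArakiMoriya2003, §11.1 Theorem 11.2 eq. (11.4)] -/
theorem normTrace_boxProd_mul_prod (S : Finset K)
    (L : List (Σ k : K, Matrix (Finset (Orb (Λ₀ k))) (Finset (Orb (Λ₀ k))) ℂ)) (hL : (L.map Sigma.fst).Nodup)
    (hLS : ∀ p ∈ L, p.1 ∈ S) :
    normTrace (boxProd hφ a ha S * (L.map fun p => fermionEmbed (φ p.1) p.2).prod) =
      (L.map fun p => normTrace (a p.1 * p.2)).prod * ∏ k ∈ S \ (L.map Sigma.fst).toFinset, normTrace (a k) := by
  induction L generalizing S with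
  | nil =>
    rw [List.map_nil, List.prod_nil, Matrix.mul_one, normTrace_boxProd, List.map_nil, List.prod_nil, one_mul,
      List.map_nil, List.toFinset_nil, Finset.sdiff_empty]
  | cons p L ih =>
    rw [List.map_cons, List.nodup_cons] at hL
    have hkS : p.1 ∈ S := hLS p List.mem_cons_self
    have hLS' : ∀ q ∈ L, q.1 ∈ S.erase p.1 := fun q hq =>
      Finset.mem_erase.2 ⟨fun h => hL.1 (h ▸ List.mem_map_of_mem hq), hLS q (List.mem_cons_of_mem _ hq)⟩
    set X := fermionEmbed (φ p.1) (a p.1)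
    set P := boxProd hφ a ha (S.erase p.1)
    set A := fermionEmbed (φ p.1) p.2
    set Q := (L.map fun q => fermionEmbed (φ q.1) q.2).prod
    have hP : P ∈ carEvenSubalgebra ((S.erase p.1).biUnion (boxOrbs φ)) := boxProd_mem_carEvenSubalgebra hφ ha _
    have hA : A ∈ carSubalgebra (boxOrbs φ p.1) := fermionEmbed_mem_carSubalgebra _ _
    have hQ : Q ∈ carSubalgebra ((S.erase p.1).biUnion (boxOrbs φ)) :=
      prod_map_fermionEmbed_box_mem_carSubalgebra L hLS'
    have hdisj : Disjoint (boxOrbs φ p.1) ((S.erase p.1).biUnion (boxOrbs φ)) :=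
      disjoint_boxOrbs_biUnion hφ (Finset.notMem_erase p.1 S)
    have hPA : Commute P A := commute_of_mem_carEvenSubalgebra hP hA hdisj.symm
    have hsd : S \ (List.map Sigma.fst (p :: L)).toFinset = S.erase p.1 \ (L.map Sigma.fst).toFinset := by
      ext k
      simp only [List.map_cons, List.toFinset_cons, Finset.mem_sdiff, Finset.mem_insert, List.mem_toFinset,
        Finset.mem_erase, not_or]
      tauto
    rw [List.map_cons, List.prod_cons, boxProd_eq_mul_erase hφ ha hkS]
    calc normTrace (X * P * (A * Q))
        = normTrace ((X * A) * (P * Q)) := by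
          rw [Matrix.mul_assoc, ← Matrix.mul_assoc P, hPA.eq]; simp only [Matrix.mul_assoc]
      _ = normTrace (X * A) * normTrace (P * Q) :=
          normTrace_mul_of_mem_carSubalgebra (Subalgebra.mul_mem _ (fermionEmbed_mem_carSubalgebra _ _) hA)
            (Subalgebra.mul_mem _ (carEvenSubalgebra_le_carSubalgebra _ hP) hQ) hdisj
      _ = normTrace (a p.1 * p.2) *
            ((L.map fun q => normTrace (a q.1 * q.2)).prod *
              ∏ k ∈ S.erase p.1 \ (L.map Sigma.fst).toFinset, normTrace (a k)) := by
          rw [← map_mul, normTrace_fermionEmbed, ih (S.erase p.1) hL.2 hLS']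
      _ = _ := by rw [List.map_cons, List.prod_cons, hsd, mul_assoc]

/-- Product formula for ONE box observable: `τ(Π_{k∈S} Γ_k a_k · Γ_j b) = τ(a_j b) · Π_{k ∈ S ∖ j} τ(a_k)` (`j ∈ S`).
[cite: ArakiMoriya2003, §11.1 Theorem 11.2 eq. (11.4)] -/
theorem normTrace_boxProd_mul_fermionEmbed {S : Finset K} {j : K} (hj : j ∈ S)
    (b : Matrix (Finset (Orb (Λ₀ j))) (Finset (Orb (Λ₀ j))) ℂ) :
    normTrace (boxProd hφ a ha S * fermionEmbed (φ j) b) = normTrace (a j * b) * ∏ k ∈ S.erase j, normTrace (a k) := by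
  have h := normTrace_boxProd_mul_prod hφ ha S [⟨j, b⟩] (by simp) (by simpa using hj)
  simp only [List.map_cons, List.map_nil, List.prod_cons, List.prod_nil, mul_one,
    List.toFinset_cons, List.toFinset_nil, insert_empty_eq] at h
  rw [h, Finset.sdiff_singleton_eq_erase]

end BoxProd

/-! ### §3. Marginals of the product state on a window -/

section PartsDisjoint

variable {Λ : Type*} {K : Type*} {Λ₀ : K → Type*} [∀ k, Fintype (Λ₀ k)] {φ : ∀ k, Λ₀ k ↪ Λ}
  (hφ : ∀ k j, k ≠ j → Disjoint ((Finset.univ : Finset (Λ₀ k)).map (φ k)) ((Finset.univ : Finset (Λ₀ j)).map (φ j)))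
  {Ω : Type*} (ι : Ω ↪ Λ) {P : K → Type*} [∀ k, Fintype (P k)] (κ : ∀ k, P k ↪ Λ₀ k) (lam : ∀ k, P k ↪ Ω)
  (hcompat : ∀ k x, φ k (κ k x) = ι (lam k x))
include hφ hcompat

/-- The parts of a partitioned window have pairwise disjoint images (inherited from the boxes): disjoint local
regions in the sense of Araki–Moriya. [cite: ArakiMoriya2003, §4.1 Def. 4.1 (2)] -/
theorem disjoint_parts_of_compat :
    ∀ k j, k ≠ j → Disjoint ((Finset.univ : Finset (P k)).map (lam k)) ((Finset.univ : Finset (P j)).map (lam j)) := by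
  intro k j hkj
  rw [Finset.disjoint_left]
  rintro y hyk hyj
  obtain ⟨x, -, rfl⟩ := Finset.mem_map.1 hyk
  obtain ⟨x', -, hx'⟩ := Finset.mem_map.1 hyj
  have h1 : φ k (κ k x) ∈ (Finset.univ : Finset (Λ₀ k)).map (φ k) := Finset.mem_map_of_mem _ (Finset.mem_univ _)
  have h2 : φ j (κ j x') ∈ (Finset.univ : Finset (Λ₀ j)).map (φ j) := Finset.mem_map_of_mem _ (Finset.mem_univ _)
  rw [hcompat, ← hx', ← hcompat] at h1
  exact Finset.disjoint_left.1 (hφ k j hkj) h1 h2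

end PartsDisjoint

section Words

variable {K : Type*} [Fintype K] {Ω : Type*} [LinearOrder Ω] [Fintype Ω]
  {P : K → Type*} [∀ k, LinearOrder (P k)] [∀ k, Fintype (P k)] (lam : ∀ k, P k ↪ Ω)
  (cls : Ω → K) (pos : ∀ y, P (cls y))

/-- The classes of `(univ : Finset K).toList.map (k ↦ ⟨k, f k⟩)` are `univ.toList` itself. [folklore] -/
private theorem map_fst_map_sigmaMk_toList {β : K → Type*} (f : ∀ k, β k) :
    (((Finset.univ : Finset K).toList.map fun k => (⟨k, f k⟩ : Σ j, β j)).map Sigma.fst) = (Finset.univ : Finset K).toList := by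
  rw [List.map_map]
  exact List.map_id'' (fun _ => rfl) _

variable [DecidableEq K]

/-- … hence they are duplicate-free and exhaust `univ`. [folklore] -/
private theorem nodup_and_sdiff_map_fst_map_sigmaMk_toList {β : K → Type*} (f : ∀ k, β k) :
    (((Finset.univ : Finset K).toList.map fun k => (⟨k, f k⟩ : Σ j, β j)).map Sigma.fst).Nodup ∧
      Finset.univ \ (((Finset.univ : Finset K).toList.map fun k => (⟨k, f k⟩ : Σ j, β j)).map Sigma.fst).toFinset = ∅ := by
  rw [map_fst_map_sigmaMk_toList]
  refine ⟨Finset.nodup_toList _, Finset.sdiff_eq_empty_iff_subset.2 fun k _ => ?_⟩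
  exact List.mem_toFinset.2 (Finset.mem_toList.2 (Finset.mem_univ k))

/-- **Every word of `𝔄_Ω` factors through the parts, up to a sign**: `wordOp w = ± Π_{k} Γ_{lam k}(b_k)`
(product over `Finset.univ.toList`), `b_k` a word of `𝔄_{P k}`, as soon as every window site lies in a part
(`lam (cls y) (pos y) = y`). [cite: ArakiMoriya2003, §11.1 Theorem 11.2 ("the monomials … are total")] -/
theorem exists_wordOp_eq_sign_smul_prod_parts (w : List (JWLetter (Orb Ω))) (hpos : ∀ y, lam (cls y) (pos y) = y) :
    ∃ (n : ℕ) (b : ∀ k, Matrix (Finset (Orb (P k))) (Finset (Orb (P k))) ℂ),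
      wordOp w = (-1 : ℂ) ^ n • ((Finset.univ : Finset K).toList.map fun k => fermionEmbed (lam k) (b k)).prod := by
  obtain ⟨n, hn⟩ := wordOp_eq_sign_smul_prod_filter (fun i : Orb Ω => cls (ofLex i).1)
    (Finset.univ : Finset K).toList (Finset.nodup_toList _) w (fun l _ => Finset.mem_toList.2 (Finset.mem_univ _))
  have hlift : ∀ k : K, ∀ v : List (JWLetter (Orb Ω)), (∀ l ∈ v, cls (ofLex l.1).1 = k) →
      ∃ u : List (JWLetter (Orb (P k))), fermionEmbed (lam k) (wordOp u) = wordOp v := by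
    intro k v hv
    induction v with
    | nil => exact ⟨[], by rw [wordOp_nil, map_one, wordOp_nil]⟩
    | cons l v ih =>
      obtain ⟨u, hu⟩ := ih fun m hm => hv m (List.mem_cons_of_mem _ hm)
      have hk := hv l List.mem_cons_self
      refine ⟨(orb (hk ▸ pos (ofLex l.1).1) (ofLex l.1).2, l.2) :: u, ?_⟩
      rw [wordOp_cons, map_mul, hu, wordOp_cons, fermionEmbed_letterOp]
      congr 2
      simp only [ofLex_toLex]
      have hsite : lam k (hk ▸ pos (ofLex l.1).1) = (ofLex l.1).1 := by
        subst hk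
        exact hpos _
      rw [hsite]
      rfl
  choose u hu using fun k => hlift k (w.filter fun l => cls (ofLex l.1).1 = k)
    (fun l hl => by simpa using (List.mem_filter.1 hl).2)
  refine ⟨n, fun k => wordOp (u k), ?_⟩
  rw [hn]
  congr 1
  exact congrArg List.prod (List.map_congr_left fun k _ => (hu k).symm)

end Words

section Marginal

variable {Λ : Type*} [LinearOrder Λ] [Fintype Λ] {K : Type*} [Fintype K] [DecidableEq K]
  {Λ₀ : K → Type*} [∀ k, LinearOrder (Λ₀ k)] [∀ k, Fintype (Λ₀ k)]
  {φ : ∀ k, Λ₀ k ↪ Λ}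
  (hφ : ∀ k j, k ≠ j → Disjoint ((Finset.univ : Finset (Λ₀ k)).map (φ k)) ((Finset.univ : Finset (Λ₀ j)).map (φ j)))
  -- the window and its parts
  {Ω : Type*} [LinearOrder Ω] [Fintype Ω] (ι : Ω ↪ Λ)
  {P : K → Type*} [∀ k, LinearOrder (P k)] [∀ k, Fintype (P k)]
  (κ : ∀ k, P k ↪ Λ₀ k) (lam : ∀ k, P k ↪ Ω)
  (hcompat : ∀ k x, φ k (κ k x) = ι (lam k x))
  (cls : Ω → K) (pos : ∀ y, P (cls y)) (hpos : ∀ y, lam (cls y) (pos y) = y)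
include hφ hcompat hpos

/-- **The marginal of a product state on a window is the product of the part marginals.** For `Θ`-even box
operators `σ_k` (density matrices in the application) on boxes `φ_k` with disjoint images TILING `Λ`
(`Σ_k |Λ₀ k| = |Λ|`), and a window `ι : Ω ↪ Λ` partitioned into parts `lam k : P k ↪ Ω` (every window site in
exactly one part, `Σ_k |P k| = |Ω|`) lying in the boxes (`φ_k ∘ κ_k = ι ∘ lam_k`):
`tr_ι (Π_k Γ_{φ_k} σ_k) = Π_k Γ_{lam_k} (tr_{κ_k} σ_k)`. A box not meeting the window (`P k` empty) contributes the
`1 × 1` factor `tr σ_k` (`= 𝟙` for a density matrix).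
[cite: ArakiMoriya2003, §4.1 Def. 4.5] [cite: ArakiMoriya2003, §11.1 Theorem 11.2] -/
theorem fermionPartialTrace_boxProd {σ : ∀ k, Matrix (Finset (Orb (Λ₀ k))) (Finset (Orb (Λ₀ k))) ℂ}
    (hσ : ∀ k, parityAut (σ k) = σ k)
    (hcardΛ : ∑ k, Fintype.card (Λ₀ k) = Fintype.card Λ) (hcardΩ : ∑ k, Fintype.card (P k) = Fintype.card Ω) :
    fermionPartialTrace ι (boxProd hφ σ hσ Finset.univ) =
      boxProd (disjoint_parts_of_compat hφ ι κ lam hcompat) (fun k => fermionPartialTrace (κ k) (σ k))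
        (fun k => parityAut_fermionPartialTrace_of_even _ (hσ k)) Finset.univ := by
  have hdisjP := disjoint_parts_of_compat hφ ι κ lam hcompat
  set m : ∀ k, Matrix (Finset (Orb (P k))) (Finset (Orb (P k))) ℂ := fun k => fermionPartialTrace (κ k) (σ k) with hm
  have hmev : ∀ k, parityAut (m k) = m k := fun k => parityAut_fermionPartialTrace_of_even _ (hσ k)
  symm
  refine eq_fermionPartialTrace_of_forall_trace_mul ι _ fun A => ?_
  -- reduce to words
  have hA : A ∈ Submodule.span ℂ {M | ∃ w : List (JWLetter (Orb Ω)), LettersIn Finset.univ w ∧ wordOp w = M} :=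
    mem_span_wordOp_of_mem_carSubalgebra (by rw [carSubalgebra_univ_eq_top]; exact Algebra.mem_top)
  refine Submodule.span_induction (p := fun A _ => (A * boxProd hdisjP m hmev Finset.univ).trace =
      (fermionEmbed ι A * boxProd hφ σ hσ Finset.univ).trace) ?_ ?_ ?_ ?_ hA
  · rintro _ ⟨w, -, rfl⟩
    obtain ⟨n, b, hw⟩ := exists_wordOp_eq_sign_smul_prod_parts lam cls pos w hpos
    rw [hw, Matrix.smul_mul, Matrix.trace_smul, map_smul, Matrix.smul_mul, Matrix.trace_smul]
    congr 1
    -- both sides are products of single-part pairings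
    set l := (Finset.univ : Finset K).toList with hl
    obtain ⟨hnd₁, hsd₁⟩ := nodup_and_sdiff_map_fst_map_sigmaMk_toList (K := K) b
    obtain ⟨hnd₂, hsd₂⟩ := nodup_and_sdiff_map_fst_map_sigmaMk_toList (K := K) fun k => fermionEmbed (κ k) (b k)
    have htwoΩ : ∀ X : Matrix (Finset (Orb Ω)) (Finset (Orb Ω)) ℂ, X.trace = 2 ^ Fintype.card (Orb Ω) * normTrace X :=
      fun X => by rw [normTrace_apply, mul_div_assoc', mul_div_cancel_left₀ _ (pow_ne_zero _ two_ne_zero)]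
    have htwoΛ : ∀ X : Matrix (Finset (Orb Λ)) (Finset (Orb Λ)) ℂ, X.trace = 2 ^ Fintype.card (Orb Λ) * normTrace X :=
      fun X => by rw [normTrace_apply, mul_div_assoc', mul_div_cancel_left₀ _ (pow_ne_zero _ two_ne_zero)]
    -- window side: `tr (Π_k Γ_{lam k} b_k · Π_k Γ_{lam k} m_k) = 2^{|Orb Ω|} Π_k τ(m_k b_k)`
    have hΩ : ((l.map fun k => fermionEmbed (lam k) (b k)).prod * boxProd hdisjP m hmev Finset.univ).trace =
        2 ^ Fintype.card (Orb Ω) * (l.map fun k => normTrace (m k * b k)).prod := by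
      have h := normTrace_boxProd_mul_prod hdisjP hmev Finset.univ
        (l.map fun k => (⟨k, b k⟩ : Σ j : K, Matrix (Finset (Orb (P j))) (Finset (Orb (P j))) ℂ))
        hnd₁ (fun p _ => Finset.mem_univ _)
      rw [hsd₁, Finset.prod_empty, mul_one] at h
      simp only [List.map_map, Function.comp_def] at h
      rw [Matrix.trace_mul_comm, htwoΩ, h]
    -- ambient side: `tr (Γ_ι(Π_k Γ_{lam k} b_k) · Π_k Γ_{φ k} σ_k) = 2^{|Orb Λ|} Π_k τ(σ_k Γ_{κ k} b_k)`
    have hemb : fermionEmbed ι (l.map fun k => fermionEmbed (lam k) (b k)).prod =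
        (l.map fun k => fermionEmbed (φ k) (fermionEmbed (κ k) (b k))).prod := by
      rw [map_list_prod, List.map_map]
      refine congrArg List.prod (List.map_congr_left fun k _ => ?_)
      simp only [Function.comp_apply]
      rw [fermionEmbed_fermionEmbed, fermionEmbed_fermionEmbed]
      exact congrFun (congrArg DFunLike.coe (fermionEmbed_congr fun x => (hcompat k x).symm)) (b k)
    have hΛ : (fermionEmbed ι (l.map fun k => fermionEmbed (lam k) (b k)).prod * boxProd hφ σ hσ Finset.univ).trace =
        2 ^ Fintype.card (Orb Λ) * (l.map fun k => normTrace (σ k * fermionEmbed (κ k) (b k))).prod := by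
      have h := normTrace_boxProd_mul_prod hφ hσ Finset.univ
        (l.map fun k => (⟨k, fermionEmbed (κ k) (b k)⟩ : Σ j : K, Matrix (Finset (Orb (Λ₀ j))) (Finset (Orb (Λ₀ j))) ℂ))
        hnd₂ (fun p _ => Finset.mem_univ _)
      rw [hsd₂, Finset.prod_empty, mul_one] at h
      simp only [List.map_map, Function.comp_def] at h
      rw [hemb, Matrix.trace_mul_comm, htwoΛ, h]
    rw [hΩ, hΛ]
    -- termwise: `2^{|Orb P k|} τ(m_k b_k) = tr (b_k · tr_κ σ_k) = tr (Γ_κ b_k · σ_k) = 2^{|Orb Λ₀ k|} τ(σ_k Γ_κ b_k)`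
    have hterm : ∀ k, normTrace (m k * b k) =
        (2 : ℂ) ^ Fintype.card (Orb (Λ₀ k)) / 2 ^ Fintype.card (Orb (P k)) *
          normTrace (σ k * fermionEmbed (κ k) (b k)) := by
      intro k
      rw [normTrace_apply, normTrace_apply, Matrix.trace_mul_comm, hm, trace_mul_fermionPartialTrace,
        Matrix.trace_mul_comm, div_mul_div_comm, mul_comm ((2 : ℂ) ^ _),
        mul_div_mul_right _ _ (pow_ne_zero _ two_ne_zero)]
    simp_rw [hterm]
    have hpow : (l.map fun k => (2 : ℂ) ^ Fintype.card (Orb (Λ₀ k)) / 2 ^ Fintype.card (Orb (P k))).prod =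
        2 ^ Fintype.card (Orb Λ) / 2 ^ Fintype.card (Orb Ω) := by
      rw [hl, Finset.prod_map_toList, Finset.prod_div_distrib, Finset.prod_pow_eq_pow_sum,
        Finset.prod_pow_eq_pow_sum, card_orb_eq_two_mul, card_orb_eq_two_mul]
      simp_rw [card_orb_eq_two_mul]
      rw [← Finset.mul_sum, ← Finset.mul_sum, hcardΛ, hcardΩ]
    rw [List.prod_map_mul, hpow]
    field_simp
  · rw [zero_mul, map_zero, zero_mul, Matrix.trace_zero, Matrix.trace_zero]
  · intro x y _ _ hx hy
    rw [add_mul, Matrix.trace_add, map_add, add_mul, Matrix.trace_add, hx, hy]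
  · intro c x _ hx
    rw [Matrix.smul_mul, Matrix.trace_smul, map_smul, Matrix.smul_mul, Matrix.trace_smul, hx]

end Marginal

end Literature.MathematicalPhysics.QuantumLattice

end
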